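import Literature.AnabelianGeometry.EtaleTheta.SettingModelKrullCuspThm16Origin
import Literature.AnabelianGeometry.EtaleTheta.SettingModelTateOriginNegShear
import Literature.AnabelianGeometry.EtaleTheta.SettingModelTateCuspOriginProfile
import HarnessLib

/-!
# `IsTateOrigin` FAILS at the untwisted Krull models `modelκ` / `modelκ′` — so `IsThm16Origin ∧ IsTateOrigin` has NO
# joint inhabitant in the model zoo (census row, kernel-certified on both sides)

abc-iut cell, layer L2, R78 / NV lane, origin-profile lineage, seat abc-iut-w5-d051 (gen 3). Mochizuki, *The étale
theta function …*, Publ. RIMS **45** (2009) [EtTh], §1 p. 13 [cite: MochizukiEtTh2009, §1 p.13]: «`G_{K_N}` acts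
trivially on `(Δ^tp_X)^ell/N·(Δ^tp_Y)^ell`», `K_N = K(ζ_N, q_X^{1/N})`; Thm. 1.6 (i) p. 24.

abc-iut-w5-d165's `SettingModelKrullCuspThm16Origin` (p442699) inhabits `IsThm16Origin` for the first time, at
abc-iut-L2-t10's cusped UNTWISTED Krull model `ThetaSetting.modelκ′ p` (`Γ ⋊_{1} G_{ℚ_p}`, `actκ_apply_eq : σ·γ = γ`,
commutator-axis cusp), and says honestly «`IsTateOrigin` for all `N` is NOT claimed and fails as at `modelχ`». This
file certifies that failure and books the resulting census row:

* `modelκ_not_isTateOrigin`, `modelκ'_not_isTateOrigin` — level `N = 3`, the argument of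
  `SettingModelChiOriginProfile.modelχ_not_isTateOrigin` (now with the public Galois input
  `exists_gal_fix_zeta_move_primeRoot` of `SettingModelTateOriginShearRigidity`): `G_{ℚ_p}` FIXES the lift `inl(η a, 1)`
  of `1 ∈ Z`, so by (b) with `k = 1` the commutator clause (c) puts `(ȳ₁^m)⁻¹` in `3·(Δ^tp_Y)^ell` for a `σ` fixing
  `ζ_3` and moving `(p²)^{1/3}` (`σ r = ζ^m r`, `0 < m < 3`) — contradicting (a′);
* **`no_joint_isThm16Origin_isTateOrigin_in_zoo`** — at each of `modelκ′` (Thm16 ✓ p442699, Tate ✗), `modelκ`,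
  `modelχq p i 2` (Tate ✓ p437913, Thm16 ✗ cusp clause), `modelχq′ p i 2` (Tate ✓, Thm16 ✗ R2, p439287):
  `¬ (IsThm16Origin ∧ IsTateOrigin)`. READING: every semi-synthetic model of the cell misses exactly one of
  {commutator-axis cusp with a COMPATIBLE Galois action, Kummer shear `|j| = 2`}; a joint inhabitant needs a Galois
  action on `Γ` that both shears `a` by `κ_p^{±2}` AND preserves the conjugacy class of the commutator axis — which the
  affine actions `actχq` do not (`SettingModelCuspAxis`), and the trivial action `actκ` does not shear.

PROOF-ONLY (no definition, no named fact). Semi-synthetic models = consistency evidence only; nothing of [EtTh]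
asserted for genuine tempered fundamental groups; no side is taken on [IUTchIII] Cor. 3.12; typed ≠ proved.
-/

noncomputable section

namespace Literature.AnabelianGeometry.EtaleTheta.SettingModel

open Literature.AnabelianGeometry.SemiGraphs Thm16Sub Function Topology

variable (p : ℕ) [Fact p.Prime]

/-- In the ell-quotient, elements of `Δ^tp_X` commute. [folklore] -/
private theorem toEll_mul_comm_of_mem_delta_κ (D : ThetaSetting p) {x y : D.PiTemp} (hx : x ∈ D.DeltaTemp)
    (hy : y ∈ D.DeltaTemp) : toEll D x * toEll D y = toEll D y * toEll D x := by
  have h := toEll_commutator_eq_one_of_mem_delta D hx hy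
  rw [map_mul, map_mul, map_mul, map_inv, map_inv, mul_inv_eq_one, mul_inv_eq_iff_eq_mul] at h
  exact h

/-- **`IsTateOrigin` FAILS at the untwisted Krull model `modelκ`** (level `N = 3`: the `a`-axis — indeed all of `Γ` —
is fixed by `G_{ℚ_p}`, so the Kummer class of `q_X = p²` would have to be a coboundary). [cite: MochizukiEtTh2009, §1 p.13] -/
theorem modelκ_not_isTateOrigin : ¬ (ThetaSetting.modelκ p).IsTateOrigin := by
  intro h
  set D := ThetaSetting.modelκ p with hD
  obtain ⟨y₁, z, ζ, r, -, hz, hzZ, hζ, hr, -, hord, htw, hkum⟩ := h.tate 3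
  have h3 : ((3 : ℕ+) : ℕ) = 3 := rfl
  rw [h3] at hζ hr hord
  have hp0 : ((p : ℕ) : PadicAlgCl p) ≠ 0 := Nat.cast_ne_zero.mpr (Fact.out : p.Prime).ne_zero
  have hr' : r ^ 3 = ((p : ℕ) : PadicAlgCl p) ^ 2 := hr
  have hr0 : r ≠ 0 := by
    rintro rfl
    rw [zero_pow three_ne_zero] at hr'
    exact pow_ne_zero 2 hp0 hr'.symm
  obtain ⟨σ, hσζ, hσr⟩ := exists_gal_fix_zeta_move_primeRoot p Nat.prime_three (by decide) hζ hr'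
  -- `σ r / r` is a cube root of unity, hence a power of the primitive `ζ`
  have hroot : (σ r / r) ^ 3 = 1 := by
    rw [div_pow, ← map_pow, hr', map_pow, map_natCast, div_self (pow_ne_zero 2 hp0)]
  obtain ⟨m, hm3, hm⟩ := hζ.eq_pow_of_pow_eq_one hroot
  have hσr' : σ r = ζ ^ m * r := by rw [hm, div_mul_cancel₀ _ hr0]
  -- the Galois element in `Π^tp_X` and the lift `z_a = inl(η a, 1)` of `1 ∈ Z`, FIXED by `G_{ℚ_p}`
  let g : D.PiTemp := (SemidirectProduct.inr σ : PiTpκ p)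
  let za : D.PiTemp :=
    (SemidirectProduct.inl ⟨(eta (FreeGroup.of 0), Multiplicative.ofAdd (1 : ℤ)), eta_a_mem_Gfpq⟩ : PiTpκ p)
  have hgza : g * za * g⁻¹ = za := by
    change (SemidirectProduct.inr σ : PiTpκ p) * SemidirectProduct.inl _ * (SemidirectProduct.inr σ)⁻¹ =
      SemidirectProduct.inl _
    rw [← map_inv, ← SemidirectProduct.inl_aut, actκ_apply_eq]
  have hza_delta : za ∈ D.DeltaTemp := (mem_deltaTempκ_iff p _).mpr (SemidirectProduct.right_inl _)
  have hza_Z : D.toZ za = Multiplicative.ofAdd 1 := by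
    change (krullTwistData p).toZ _ = _
    rw [GfpTwistData.toZ_apply, SemidirectProduct.left_inl, gfpSnd_apply]
  let y₀ : D.PiTemp := za⁻¹ * z
  have hy₀_delta : y₀ ∈ D.DeltaTemp := D.DeltaTemp.mul_mem (D.DeltaTemp.inv_mem hza_delta) hz
  have hy₀_Y : y₀ ∈ D.GtpY := by
    change y₀ ∈ D.toZ.ker
    rw [MonoidHom.mem_ker, map_mul, map_inv, hza_Z, hzZ, inv_mul_cancel]
  have hy₀ : y₀ ∈ D.DtpY := Subgroup.mem_inf.mpr ⟨hy₀_Y, hy₀_delta⟩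
  have hz_eq : z = za * y₀ := by rw [mul_inv_cancel_left]
  -- the aug-values of `g`
  have haug : ∀ x : PadicAlgCl p, D.aug g x = σ x := fun x => rfl
  have haugζ : D.aug g ζ = ζ ^ 1 := by rw [haug, pow_one, hσζ]
  have haugr : D.aug g r = ζ ^ m * r := by rw [haug, hσr']
  -- the commutator `[g, z]` in the ell-quotient
  have hgy₀_delta : g * y₀ * g⁻¹ ∈ D.DeltaTemp := (deltaTemp_normal D).conj_mem _ hy₀_delta g
  have hkey : toEll D (g * z * g⁻¹ * z⁻¹) = toEll D (g * y₀ * g⁻¹) * (toEll D y₀)⁻¹ := by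
    have hc : g * z * g⁻¹ * z⁻¹ = za * ((g * y₀ * g⁻¹) * y₀⁻¹) * za⁻¹ := by
      rw [hz_eq, mul_inv_rev]
      calc g * (za * y₀) * g⁻¹ * (y₀⁻¹ * za⁻¹)
          = (g * za * g⁻¹) * (g * y₀ * g⁻¹) * y₀⁻¹ * za⁻¹ := by group
        _ = za * (g * y₀ * g⁻¹) * y₀⁻¹ * za⁻¹ := by rw [hgza]
        _ = za * ((g * y₀ * g⁻¹) * y₀⁻¹) * za⁻¹ := by group
    rw [hc, map_mul, map_mul, toEll_mul_comm_of_mem_delta_κ p D hza_delta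
      (D.DeltaTemp.mul_mem hgy₀_delta (D.DeltaTemp.inv_mem hy₀_delta)), map_inv, mul_assoc,
      mul_inv_cancel, mul_one, map_mul, map_inv]
  -- clause (b) with `k = 1`, clause (c), and the order clause (a′)
  have hb := htw g 1 haugζ y₀ hy₀
  rw [pow_one] at hb
  have hc := hkum g m haugr
  rw [hkey] at hc
  have hmem : toEll D y₁ ^ m ∈ ellPowersY D 3 := by
    have := (ellPowersY D 3).mul_mem ((ellPowersY D 3).inv_mem hb) hc
    rwa [inv_mul_cancel_left, inv_mem_iff] at this
  rw [hord m] at hmem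
  have hm0 : m = 0 := Nat.eq_zero_of_dvd_of_lt hmem hm3
  exact hσr (by rw [hσr', hm0, pow_zero, one_mul])

/-- **`IsTateOrigin` FAILS at the cusped untwisted Krull model `modelκ′`** (the clause does not read the cusp;
transport of `modelκ_not_isTateOrigin`). [cite: MochizukiEtTh2009, §1 p.13] -/
theorem modelκ'_not_isTateOrigin : ¬ (ThetaSetting.modelκ' p).IsTateOrigin :=
  fun h => modelκ_not_isTateOrigin p ⟨h.tate⟩

/-- **CENSUS ROW: no model of the zoo inhabits `IsThm16Origin ∧ IsTateOrigin`.** At `modelκ′` (Thm16 ✓, Tate ✗), at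
`modelκ` (both ✗), at `modelχq p i 2` (Tate ✓, Thm16 ✗ by the cusp clause) and at `modelχq′ p i 2` (Tate ✓, Thm16 ✗
by R2). [cite: MochizukiEtTh2009, §1 p.13] -/
theorem no_joint_isThm16Origin_isTateOrigin_in_zoo (i : ℤ) :
    ¬ ((ThetaSetting.modelκ' p).IsThm16Origin ∧ (ThetaSetting.modelκ' p).IsTateOrigin) ∧
      ¬ ((ThetaSetting.modelκ p).IsThm16Origin ∧ (ThetaSetting.modelκ p).IsTateOrigin) ∧
      ¬ ((ThetaSetting.modelχq p i 2 even_two).IsThm16Origin ∧ (ThetaSetting.modelχq p i 2 even_two).IsTateOrigin) ∧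
      ¬ ((ThetaSetting.modelχq' p i 2 even_two).IsThm16Origin ∧
          (ThetaSetting.modelχq' p i 2 even_two).IsTateOrigin) :=
  ⟨fun h => modelκ'_not_isTateOrigin p h.2, fun h => modelκ_not_isTateOrigin p h.2,
    fun h => not_isThm16Origin_modelχq p i h.1, fun h => not_isThm16Origin_modelχq' p i h.1⟩

/-- **What IS jointly inhabited** (positive side of the same row): `IsEtThOrigin ∧ IsThm16Origin` at `modelκ′`
(abc-iut-w5-d165) and `IsEtThOrigin ∧ IsTateOrigin` at `modelχq p i j` for `j = ±2` (this lineage) — in two DIFFERENT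
models. [cite: MochizukiEtTh2009, §1 p.13] -/
theorem isThm16Origin_and_isTateOrigin_separately (i : ℤ) :
    ((ThetaSetting.modelκ' p).IsEtThOrigin ∧ (ThetaSetting.modelκ' p).IsThm16Origin) ∧
      ((ThetaSetting.modelχq p i 2 even_two).IsEtThOrigin ∧ (ThetaSetting.modelχq p i 2 even_two).IsTateOrigin) ∧
      ((ThetaSetting.modelχq p i (-2) (Even.neg even_two)).IsEtThOrigin ∧
        (ThetaSetting.modelχq p i (-2) (Even.neg even_two)).IsTateOrigin) :=
  ⟨⟨ThetaSetting.modelκ'_isEtThOrigin p, ThetaSetting.modelκ'_isThm16Origin p⟩,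
    ⟨ThetaSetting.modelχq_isEtThOrigin p i 2 even_two, modelχq_isTateOrigin p i⟩,
    ⟨ThetaSetting.modelχq_isEtThOrigin p i (-2) (Even.neg even_two), modelχq_negTwo_isTateOrigin p i⟩⟩

end Literature.AnabelianGeometry.EtaleTheta.SettingModel

end
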